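import Summits.BirchSwinnertonDyer.BirchSwinnertonDyer.Theorems.ResidualThetaTransportAtTwoResidualSignedLambdaLowerCMAtTwoRhoLayerPairingConj
import Summits.BirchSwinnertonDyer.BirchSwinnertonDyer.Theorems.ResidualThetaTransportAtTwoResidualSignedLambdaLowerCMAtTwoRhoLayerPairingCoeffSmul
import HarnessLib

/-!
# K-c (glue): the two `hsemi` DISCHARGERS `hX`, `hC` of S2's Coleman-side injectivity, for `𝒸 = col^{⊕r} ∘ locd₂`, in the currency of
# `ColemanSideInjective.eq_zero_of_apply_smul_zeta_eq_zero_two_of_X_of_C` — from (P2)_ρ (`…RhoLayerPairingConj`) and LIN-C₀ (`…RhoLayerPairingCoeffSmul`)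

Route `ResidualThetaTransportAtTwo` (RTT), crux RSL_g `ResidualSignedLambdaLowerCMAtTwo` (stmt-BirchSwinnertonDyer-22608); width seat
`bsd-wall-tp2-p2x-w2` g18 (`--supports`, closes nothing). THEOREMS ONLY (no definition, no named fact, no instance, no `sorry`). BSD is not proved
by any of this; RSL_g is not proved here. STUB-PLAN rev 18 §3 item 4 (ASSEMBLY) / Q78: the `hsemi` of w3's `…ColemanSideInjective` /
`…ColemanSidePush` (`hX : ∀ x ∈ Λ_𝒪 z, 𝒸 (j X • x) = X • 𝒸 x`, `hC : ∀ a, ∀ x ∈ Λ_𝒪 z, 𝒸 (j (C a) • x) = C a • 𝒸 x`, `j : ℤ_p⟦X⟧ →+* 𝒪⟦X⟧`) holds for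
EVERY `x ∈ 𝐇¹_Γ(T)`, for any additive `𝒸 : 𝐇¹ →+ (Fin r → ℤ_p⟦X⟧)` whose coordinates are `col (locd₂ x ∘ single_i)` (the registered `Lines/onepair.lean`'s
`fun x i ↦ col ((locd₂ x).comp (AddMonoidHom.single _ i))`).

* §1 (generic `T` with coefficients `A`, `I : IwasawaH1DataCoeff T p κ γ`, hypotheses (P2) `hP2` and (PC) `hPC` on `pair`): **`cTuple_map_X_smul`**,
  **`cTuple_map_C_smul`**.
* §2 (`ρ`, every `pair` PINNED by its residues `toZModPow k (pair m x Q) = rhoLayerPairingPk … m k x Q` — the `pair` binder of `Lines/onepair.lean`):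
  **`cTuple_map_X_smul_of_toZModPow`**, **`cTuple_map_C_smul_of_toZModPow`** ((P2) by `pair_conjMap_of_toZModPow`, (PC) by
  `pair_padicInt_smul_of_toZModPow`), and with `j := PowerSeries.map (padicIntToCoeffIntegers S)`: **`cTuple_mapCoeff_X_smul`**, **`cTuple_mapCoeff_C_smul`**.

References: [Kato2004Asterisque] §12.2 (p. 220), §13.8 (pp. 228–229), §17.13 (p. 279); [Kobayashi2003] Thm. 6.2 (6.13), §8 (8.20)–(8.23);
[Sprung2012] Def. 3.1, Def. 5.9; [PerrinRiou1994Invent] §3.6.1.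
-/

set_option autoImplicit false
-- the Theorems namespace of this sub repeats the summit name by design (D-0017 nested layout)
set_option linter.dupNamespace false

noncomputable section

open scoped Classical

namespace Summit.BirchSwinnertonDyer.BirchSwinnertonDyer.Theorems.ThetaTransport

open CategoryTheory Field NumberField IsDedekindDomain WeierstrassCurve
  Literature.NumberTheory.EllipticCurves Literature.NumberTheory.GaloisRepresentations
  Literature.NumberTheory.EllipticCurves.Kobayashi2003 Literature.NumberTheory.EllipticCurves.Sprung2012
  Literature.NumberTheory.EllipticCurves.GreenbergSelmer Literature.NumberTheory.EllipticCurves.CyclotomicLayer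
  Literature.NumberTheory.EllipticCurves.Kato2004
  Literature.NumberTheory.GaloisCohomology ZpExtension

/-! ## §1 Generic coefficients: `hX` from (P2) and the twist clause, `hC` from (PC) and linearity of `col` -/

section Generic

variable {p : ℕ} [Fact p.Prime] {A : Type} [CommRing A] [TopologicalSpace A] {M : Type} [AddCommGroup M] [Module A M]
  [TopologicalSpace M] [IsTopologicalAddGroup M] [ContinuousSMul A M] {T : GaloisRep ℚ A M}
  {κ : ZpExtension ℚ p} {γ : absoluteGaloisGroup ℚ} (I : IwasawaH1DataCoeff T p κ γ)
  (W : WeierstrassCurve ℚ) (v : HeightOneSpectrum (𝓞 ℚ)) {r : ℕ}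
  {pair : ∀ n : ℕ, H1 T (κ.layerSubgroup n) →+
    ((Fin r → localLayerPointsOfEmb κ (closureEmb (K := ℚ) (v.adicCompletion ℚ)) W n) →+ ℤ_[p])}
  {locd₂ : I.H →+ ((Fin r → localTowerPointsOfEmb κ (closureEmb (K := ℚ) (v.adicCompletion ℚ)) W) →+ ℤ_[p])}
  (hlocd : ∀ (n : ℕ) (x : I.H) (Q : Fin r → localPoints W (v.adicCompletion ℚ))
    (hQ : ∀ i, Q i ∈ localLayerPointsOfEmb κ (closureEmb (K := ℚ) (v.adicCompletion ℚ)) W n),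
    locd₂ x (fun i => ⟨Q i, localLayerPointsOfEmb_le_localTowerPointsOfEmb κ _ W n (hQ i)⟩) = pair n (I.proj n x) (fun i => ⟨Q i, hQ i⟩))
  (col : (localTowerPointsOfEmb κ (closureEmb (K := ℚ) (v.adicCompletion ℚ)) W →+ ℤ_[p]) →ₗ[ℤ_[p]] PowerSeries ℤ_[p])
  (𝒸 : I.H →+ (Fin r → PowerSeries ℤ_[p]))
  (h𝒸 : ∀ (x : I.H) (i : Fin r), 𝒸 x i =
    col ((locd₂ x).comp (AddMonoidHom.single (fun _ : Fin r => ↥(localTowerPointsOfEmb κ (closureEmb (K := ℚ) (v.adicCompletion ℚ)) W)) i)))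
  (j : PowerSeries ℤ_[p] →+* PowerSeries A)

include hlocd h𝒸 in
/-- **`hX` for `𝒸 = col^{⊕r} ∘ locd₂`**: `𝒸 (j X • x) = X • 𝒸 x` for EVERY `x ∈ 𝐇¹_Γ(T)`, given (P2) for `pair` at a local `g` with `κ (res g) = 1 = κ γ`, the layer
formula of `locd₂`, the twist clause `col (z ∘ g⁻¹) = (1 + X)·col z` of the plus Coleman map and `j X = X` (`colTuple_locd₂_X_smul`). [cite: Kobayashi2003, Thm. 6.2 (6.13) (p. 12)]
[cite: Kato2004Asterisque, §12.2 (p. 220)] [cite: Sprung2012, Def. 5.9 (p. 1495)] -/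
theorem cTuple_map_X_smul (hjX : j PowerSeries.X = PowerSeries.X) (hγ : κ.IsTopGenerator γ) {g : absoluteGaloisGroup (v.adicCompletion ℚ)}
    (hg : κ.IsTopGenerator (resGalOfEmb (closureEmb (K := ℚ) (v.adicCompletion ℚ)) g))
    (hP2 : ∀ (n : ℕ) (y : H1 T (κ.layerSubgroup n)) (Q : Fin r → localPoints W (v.adicCompletion ℚ))
      (hQ : ∀ i, Q i ∈ localLayerPointsOfEmb κ (closureEmb (K := ℚ) (v.adicCompletion ℚ)) W n),
      pair n (conjMap T.toTopRep (κ.layerSubgroup n) (resGalOfEmb (closureEmb (K := ℚ) (v.adicCompletion ℚ)) g) 1 y)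
          (fun i => ⟨g • Q i, smul_mem_localLayerPointsOfEmb κ (closureEmb (K := ℚ) (v.adicCompletion ℚ)) W n g (hQ i)⟩) =
        pair n y (fun i => ⟨Q i, hQ i⟩))
    (hcol : ∀ z z' : localTowerPointsOfEmb κ (closureEmb (K := ℚ) (v.adicCompletion ℚ)) W →+ ℤ_[p],
      (∀ a : localTowerPointsOfEmb κ (closureEmb (K := ℚ) (v.adicCompletion ℚ)) W,
        z' a = z ⟨g⁻¹ • (a : localPoints W (v.adicCompletion ℚ)), smul_mem_localTowerPointsOfEmb κ _ W g⁻¹ a.2⟩) →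
      col z' = (1 + PowerSeries.X) * col z)
    (x : I.H) :
    𝒸 (j PowerSeries.X • x) = (PowerSeries.X : PowerSeries ℤ_[p]) • 𝒸 x := by
  funext i
  have h := congr_fun (colTuple_locd₂_X_smul I W v hγ hg hP2 hlocd col.toAddMonoidHom hcol x) i
  rw [Pi.smul_apply] at h ⊢
  rw [hjX, h𝒸, h𝒸]
  exact h

include hlocd h𝒸 in
/-- **`hC` for `𝒸 = col^{⊕r} ∘ locd₂`**: `𝒸 (j (C a) • x) = C a • 𝒸 x` for EVERY `x ∈ 𝐇¹_Γ(T)` and `a ∈ ℤ_p`, given (PC) `pair n (ι a • y) Q = a · pair n y Q`,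
the layer formula of `locd₂`, `ℤ_p`-linearity of `col` and `j (C a) = C (ι a)` (`colTuple_locd₂_C_smul`). [cite: Kato2004Asterisque, §12.2 (p. 220), §13.8 (p. 228)] -/
theorem cTuple_map_C_smul (ι : ℤ_[p] →+* A) (hjC : ∀ a : ℤ_[p], j (PowerSeries.C a) = PowerSeries.C (ι a))
    (hPC : ∀ (c : ℤ_[p]) (n : ℕ) (y : H1 T (κ.layerSubgroup n))
      (Q : Fin r → localLayerPointsOfEmb κ (closureEmb (K := ℚ) (v.adicCompletion ℚ)) W n), pair n (ι c • y) Q = c * pair n y Q)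
    (a : ℤ_[p]) (x : I.H) :
    𝒸 (j (PowerSeries.C a) • x) = (PowerSeries.C a : PowerSeries ℤ_[p]) • 𝒸 x := by
  funext i
  have h := congr_fun (colTuple_locd₂_C_smul I W v (hPC a) hlocd col x) i
  rw [Pi.smul_apply] at h ⊢
  rw [hjC, h𝒸, h𝒸, smul_eq_mul, ← PowerSeries.smul_eq_C_mul]
  exact h

end Generic

/-! ## §2 `ρ`: the dischargers for every residue-pinned `pair` (the binder currency of `Lines/onepair.lean`) -/

section Rho

variable {p : ℕ} [Fact p.Prime] (S : Set (PadicAlgCl p)) {d : ℕ} (ρ : FramedGaloisRep ℚ ↥(padicCoeffIntegers S) d)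
  (W : WeierstrassCurve ℚ) [W.IsElliptic] {r : ℕ}
  (ePk : ∀ k : ℕ, ↥(AddSubgroup.torsionBy (Cofree ρ ↥(padicCoeffField S)) ((p ^ k : ℕ) : ℤ)) →
    ↥(AddSubgroup.torsionBy (Cofree ρ ↥(padicCoeffField S)) ((p ^ k : ℕ) : ℤ)) → AlgebraicClosure ℚ)
  (hμPk : ∀ k a b, ePk k a b ^ (p ^ k) = 1)
  (hadd₁Pk : ∀ k a₁ a₂ b, ePk k (a₁ + a₂) b = ePk k a₁ b * ePk k a₂ b)
  (hadd₂Pk : ∀ k a b₁ b₂, ePk k a (b₁ + b₂) = ePk k a b₁ * ePk k a b₂)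
  (hgalPk : ∀ k (σ : absoluteGaloisGroup ℚ) (a b : ↥(AddSubgroup.torsionBy (Cofree ρ ↥(padicCoeffField S)) ((p ^ k : ℕ) : ℤ))),
    σ • ePk k a b = ePk k (cofreeTorsionGaloisModule S ρ _ σ a) (cofreeTorsionGaloisModule S ρ _ σ b))
  (Θ : Cofree ρ ↥(padicCoeffField S) ≃+ (Fin r → ↥(W.geomPrimaryTorsion p))) {κ : ZpExtension ℚ p} {γ : absoluteGaloisGroup ℚ}
  (v : HeightOneSpectrum (𝓞 ℚ))
  (hΘ : ∀ (δ : absoluteGaloisGroup (v.adicCompletion ℚ)) (m : Cofree ρ ↥(padicCoeffField S)) (i : Fin r),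
    Θ (resGalOfEmb (closureEmb (K := ℚ) (v.adicCompletion ℚ)) δ • m) i =
      resGalOfEmb (closureEmb (K := ℚ) (v.adicCompletion ℚ)) δ • Θ m i)
  (I : IwasawaH1DataCoeff (FramedGaloisRep.toGaloisRep ρ) p κ γ)
  (pair : ∀ n : ℕ, H1 (FramedGaloisRep.toGaloisRep ρ) (κ.layerSubgroup n) →+
    ((Fin r → localLayerPointsOfEmb κ (closureEmb (K := ℚ) (v.adicCompletion ℚ)) W n) →+ ℤ_[p]))
  (hpair : ∀ (n k : ℕ) (x : H1 (FramedGaloisRep.toGaloisRep ρ) (κ.layerSubgroup n))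
    (Q : Fin r → localLayerPointsOfEmb κ (closureEmb (K := ℚ) (v.adicCompletion ℚ)) W n),
    PadicInt.toZModPow k (pair n x Q) = rhoLayerPairingPk S ρ W ePk hμPk hadd₁Pk hadd₂Pk hgalPk Θ κ v hΘ n k x Q)
  {locd₂ : I.H →+ ((Fin r → localTowerPointsOfEmb κ (closureEmb (K := ℚ) (v.adicCompletion ℚ)) W) →+ ℤ_[p])}
  (hlocd : ∀ (n : ℕ) (x : I.H) (Q : Fin r → localPoints W (v.adicCompletion ℚ))
    (hQ : ∀ i, Q i ∈ localLayerPointsOfEmb κ (closureEmb (K := ℚ) (v.adicCompletion ℚ)) W n),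
    locd₂ x (fun i => ⟨Q i, localLayerPointsOfEmb_le_localTowerPointsOfEmb κ _ W n (hQ i)⟩) = pair n (I.proj n x) (fun i => ⟨Q i, hQ i⟩))
  (col : (localTowerPointsOfEmb κ (closureEmb (K := ℚ) (v.adicCompletion ℚ)) W →+ ℤ_[p]) →ₗ[ℤ_[p]] PowerSeries ℤ_[p])
  (𝒸 : I.H →+ (Fin r → PowerSeries ℤ_[p]))
  (h𝒸 : ∀ (x : I.H) (i : Fin r), 𝒸 x i =
    col ((locd₂ x).comp (AddMonoidHom.single (fun _ : Fin r => ↥(localTowerPointsOfEmb κ (closureEmb (K := ℚ) (v.adicCompletion ℚ)) W)) i)))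

include hpair hlocd h𝒸 in
/-- **`hX` for the pinned `ρ`-pairings**: `𝒸 (j X • x) = X • 𝒸 x` for every `x ∈ 𝐇¹_Γ(T_ρ)`, for every `pair` pinned by its residues ((P2) is
`pair_conjMap_of_toZModPow`), given `κ γ = 1 = κ (res g)`, the twist clause of `col` at `g`, and `j X = X`. [cite: Kobayashi2003, Thm. 6.2 (6.13) (p. 12)]
[cite: Kato2004Asterisque, §12.2 (p. 220), §13.8 (pp. 228–229)] -/
theorem cTuple_map_X_smul_of_toZModPow (j : PowerSeries ℤ_[p] →+* PowerSeries ↥(padicCoeffIntegers S)) (hjX : j PowerSeries.X = PowerSeries.X)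
    (hγ : κ.IsTopGenerator γ) {g : absoluteGaloisGroup (v.adicCompletion ℚ)}
    (hg : κ.IsTopGenerator (resGalOfEmb (closureEmb (K := ℚ) (v.adicCompletion ℚ)) g))
    (hcol : ∀ z z' : localTowerPointsOfEmb κ (closureEmb (K := ℚ) (v.adicCompletion ℚ)) W →+ ℤ_[p],
      (∀ a : localTowerPointsOfEmb κ (closureEmb (K := ℚ) (v.adicCompletion ℚ)) W,
        z' a = z ⟨g⁻¹ • (a : localPoints W (v.adicCompletion ℚ)), smul_mem_localTowerPointsOfEmb κ _ W g⁻¹ a.2⟩) →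
      col z' = (1 + PowerSeries.X) * col z)
    (x : I.H) :
    𝒸 (j PowerSeries.X • x) = (PowerSeries.X : PowerSeries ℤ_[p]) • 𝒸 x :=
  cTuple_map_X_smul I W v hlocd col 𝒸 h𝒸 j hjX hγ hg
    (fun n y Q hQ => pair_conjMap_of_toZModPow S ρ W Θ κ v hΘ ePk hμPk hadd₁Pk hadd₂Pk hgalPk pair hpair n g y Q hQ) hcol x

include hpair hlocd h𝒸 in
/-- **`hC` for the pinned `ρ`-pairings**: `𝒸 (j (C a) • x) = C a • 𝒸 x` for every `x ∈ 𝐇¹_Γ(T_ρ)` and `a ∈ ℤ_p`, for every `pair` pinned by its residues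
((PC) is `pair_padicInt_smul_of_toZModPow`), given `j (C a) = C (ι a)` with `ι = padicIntToCoeffIntegers S`. [cite: Kato2004Asterisque, §12.2 (p. 220), §13.8 (pp. 228–229)] -/
theorem cTuple_map_C_smul_of_toZModPow (j : PowerSeries ℤ_[p] →+* PowerSeries ↥(padicCoeffIntegers S))
    (hjC : ∀ a : ℤ_[p], j (PowerSeries.C a) = PowerSeries.C (padicIntToCoeffIntegers S a)) (a : ℤ_[p]) (x : I.H) :
    𝒸 (j (PowerSeries.C a) • x) = (PowerSeries.C a : PowerSeries ℤ_[p]) • 𝒸 x :=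
  cTuple_map_C_smul I W v hlocd col 𝒸 h𝒸 j (padicIntToCoeffIntegers S) hjC
    (fun c n y Q => pair_padicInt_smul_of_toZModPow S ρ W ePk hμPk hadd₁Pk hadd₂Pk hgalPk Θ κ v hΘ pair hpair n c y Q) a x

include hpair hlocd h𝒸 in
/-- `hX` with the coefficientwise inclusion `j := PowerSeries.map ι : ℤ_p⟦X⟧ →+* 𝒪⟦X⟧` (`PowerSeries.map_X`). [cite: Kobayashi2003, Thm. 6.2 (6.13) (p. 12)]
[cite: Kato2004Asterisque, §12.2 (p. 220)] -/
theorem cTuple_mapCoeff_X_smul (hγ : κ.IsTopGenerator γ) {g : absoluteGaloisGroup (v.adicCompletion ℚ)}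
    (hg : κ.IsTopGenerator (resGalOfEmb (closureEmb (K := ℚ) (v.adicCompletion ℚ)) g))
    (hcol : ∀ z z' : localTowerPointsOfEmb κ (closureEmb (K := ℚ) (v.adicCompletion ℚ)) W →+ ℤ_[p],
      (∀ a : localTowerPointsOfEmb κ (closureEmb (K := ℚ) (v.adicCompletion ℚ)) W,
        z' a = z ⟨g⁻¹ • (a : localPoints W (v.adicCompletion ℚ)), smul_mem_localTowerPointsOfEmb κ _ W g⁻¹ a.2⟩) →
      col z' = (1 + PowerSeries.X) * col z)
    (x : I.H) :
    𝒸 (PowerSeries.map (padicIntToCoeffIntegers S) PowerSeries.X • x) = (PowerSeries.X : PowerSeries ℤ_[p]) • 𝒸 x :=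
  cTuple_map_X_smul_of_toZModPow S ρ W ePk hμPk hadd₁Pk hadd₂Pk hgalPk Θ v hΘ I pair hpair hlocd col 𝒸 h𝒸
    (PowerSeries.map (padicIntToCoeffIntegers S)) (PowerSeries.map_X _) hγ hg hcol x

include hpair hlocd h𝒸 in
/-- `hC` with the coefficientwise inclusion `j := PowerSeries.map ι` (`PowerSeries.map_C`). [cite: Kato2004Asterisque, §12.2 (p. 220), §13.8 (p. 228)] -/
theorem cTuple_mapCoeff_C_smul (a : ℤ_[p]) (x : I.H) :
    𝒸 (PowerSeries.map (padicIntToCoeffIntegers S) (PowerSeries.C a) • x) = (PowerSeries.C a : PowerSeries ℤ_[p]) • 𝒸 x :=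
  cTuple_map_C_smul_of_toZModPow S ρ W ePk hμPk hadd₁Pk hadd₂Pk hgalPk Θ v hΘ I pair hpair hlocd col 𝒸 h𝒸
    (PowerSeries.map (padicIntToCoeffIntegers S)) (fun a => PowerSeries.map_C _ a) a x

end Rho

end Summit.BirchSwinnertonDyer.BirchSwinnertonDyer.Theorems.ThetaTransport

end
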